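import Literature.MathematicalPhysics.QuantumFieldTheory.Balaban1983to89.B11Eq80Current
import Literature.Analysis.Complex.HolomorphicBanach

/-!
# `Balaban1983to89.B11Eq78QuadLetterModulus` — T. Bałaban, *The variational problem and background fields in renormalization group method for lattice gauge theories*, Commun. Math. Phys. **102** (1985) 277–309 [Balaban1985Variational]: (56) p. 286 and (78) p. 290 (the quadratic letter `HC^{(2)}(A′)`), (53)–(54) p. 286 (Cauchy) — THE QUADRATIC LETTER `HC^{(2)}` READ ACROSS TWO CARRIERS (115): its modulus `δ_Q` REDUCED to the displayed defects `δ_H` of `H` and `δ_C` of `C` by Cauchy's inequality for the second Fréchet derivative of the difference map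

statement-level skeleton of published theorems with citation tags; proofs where landed; nothing here is a claim about the Yang–Mills mass gap

PDF held: `paper:balaban1985-cmp102-variational-background` (journal page = PDF page + 276); p. 286 (53)–(56) and p. 290 (78) read on the text layer by
this lineage (displays transcribed in `B11Eq80Current`: `quadPart F Y = ½·D²F(0)(Y, Y)` = print's `C^{(2)}`/`D^{(2)}`).

CITATION HEADER (lean-in-tree rule 2026-08-18).  WHAT IS REPRODUCED: nothing of print is asserted.  p. 290 (78): *«the second order term D^{(2)}(A′) in the
expansion of D(A′) is equal to C^{(2)}(A′)»*; p. 286 (53)–(54): the Cauchy device on complex discs.  The pub-balaban NE9 chain compares the chart of the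
species `cur U` at a background and at the flat background; this lineage's `B11Eq98W80BackgroundModulus.exists_W80_background_modulus` DISPLAYS the modulus
(δ_Q) `‖ι(H₁C₁^{(2)}(x)) − H₂C₂^{(2)}(ιx)‖ ≤ δ_Q` of the quadratic letter across the two carriers.  THIS FILE reduces δ_Q to the two letter defects the
OWNER's files already display ∕ produce: `δ_H` (`‖ι(H₁B) − H₂B‖ ≤ δ_H‖B‖`, `B11Eq120SolutionContinuity.norm_map_sectC_sub_le`'s `hδH`) and `δ_C`
(`‖C₁y − C₂(ιy)‖ ≤ δ_C` on a ball, its `hδC`; at the flat point `B11Eq44COperatorModulus.exists_Cc_modulus_at_flat`).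

WHAT IS PROVED (sorry-free; axioms standard; 0 def; [folklore] throughout).
§1 GENERIC (complex normed `E, E′`, complete `F`): `norm_iteratedFDeriv_two_apply_le_of_ball_bound` (‖D²F(0)(Y,Y)‖ ≤ 16M∕s²·‖Y‖² from `‖F‖ ≤ M` on
   `‖z‖ < s` — [Chae1985] 13.6 via the tree's `HolomorphicBanach.norm_iteratedFDeriv_le_of_closedBall` on `closedBall 0 (s∕2)`, step `s∕4`);
   `iteratedFDeriv_two_sub_apply` (additivity at `0` for maps holomorphic on a ball — `AnalyticAt.contDiffAt`); `iteratedFDeriv_two_comp_clm_apply`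
   (`D²(F ∘ ι)(0)(Y,Y) = D²F(0)(ιY, ιY)` for a continuous linear `ι` — Mathlib's `ContinuousLinearMap.iteratedFDerivWithin_comp_right` on the open ball).
§2 ON THE CARRIERS (115): `norm_quadPart_le_of_ball_bound` (‖F^{(2)}(Y)‖ ≤ 8M∕s²·‖Y‖²), `quadPart_sub`, `quadPart_comp_clm`.
§3 **`norm_quadLetter_sub_le`**: for `C₁ : 𝒴₁ → 𝒳`, `C₂ : 𝒴₂ → 𝒳` holomorphic on `‖·‖ < c` with `‖C₁Y‖ ≤ C_q‖Y‖²` there, a continuous linear `ι : 𝒴₁ → 𝒴₂` with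
   `‖ιv‖ ≤ K_ι‖v‖`, operator letters `H₁ : 𝒳 →L 𝒴₁`, `H₂ : 𝒳 →L 𝒴₂` with `‖H₂‖ ≤ b`, defects `‖ι(H₁B) − H₂B‖ ≤ δ_H‖B‖` and `‖C₁y − C₂(ιy)‖ ≤ δ_C` on `‖y‖ < s`
   (`s ≤ c`, `K_ιs ≤ c`): **`‖ι(H₁C₁^{(2)}(x)) − H₂C₂^{(2)}(ιx)‖ ≤ (8C_qδ_H + 8bδ_C∕s²)·‖x‖²`** for every `x`; **`quadLetter_modulus_on_ball`** — hence the
   display (δ_Q) of `exists_W80_background_modulus` on `‖x‖ < a_C` with `δ_Q := (8C_qδ_H + 8bδ_C∕s²)·a_C²`.  `ι` is ANY continuous linear map (the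
   consumer's is the jet identity `toContinuousLinearMap ((jetLinearEquiv ∇₂)⁻¹ ∘ jetLinearEquiv ∇₁)`).

HONEST SCOPE — what is NOT claimed.  (i) Crude Cauchy constants on half balls (factor 8), per lattice through `δ_H, δ_C`; nothing of (56)/(78) or
Prop. 4 is proved.  (ii) `δ_H, δ_C` stay LETTERS here (their suppliers are the OWNER's files named above).  (iii) NOT summit progress (cell pub-balaban:
NE9 NOT PRINTED ∕ NOT PROVED; «NE9 ⇐ the named binders»; spine PROVED 0/9; HONEST DEPENDENCY: continuum YM on T⁴ ⇐ BetaPertH ∧ nine spine estimates (0/9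
proved); BetaPertH ⇐ (D1) ∧ (D4) ∧ CAP+tail; G-an2-4 gates asym, D1 and NE2/3/4).  Unit `b2b-balaban-t4-ne9-formalise-leaf-05` (NE9 crux-team leaf
prover, gen 70).  Imports `B11Eq80Current` and `Literature.Analysis.Complex.HolomorphicBanach` ONLY; modifies nothing.
-/

noncomputable section

open Metric Set Filter Topology

namespace Literature.MathematicalPhysics.QuantumFieldTheory.Balaban1983to89.B11Eq78QuadLetterModulus

open Literature.MathematicalPhysics.QuantumFieldTheory.Balaban1983to89.B11Eq80Current (quadPart)
open Literature.Analysis.Complex.HolomorphicBanach (norm_iteratedFDeriv_le_of_closedBall analyticOnNhd_of_differentiableOn)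
open B9SectCLatticeCarrier (Bond)
open B11Eq115Space

/-! ## §1 Generic: the second Fréchet derivative at `0` of maps holomorphic on a ball -/

section Generic

variable {E E' F : Type*} [NormedAddCommGroup E] [NormedSpace ℂ E] [NormedAddCommGroup E'] [NormedSpace ℂ E']
  [NormedAddCommGroup F] [NormedSpace ℂ F] [CompleteSpace F]

omit [NormedSpace ℂ E] [CompleteSpace F] in
/-- The norm-ball `{z | ‖z‖ < s}` is open (private helper). [folklore] -/
private theorem isOpen_normBall (s : ℝ) : IsOpen {z : E | ‖z‖ < s} := isOpen_lt continuous_norm continuous_const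

/-- **CAUCHY FOR `D²F(0)` FROM A VALUE BOUND ON A BALL**: `F` complex-differentiable on `‖z‖ < s` (`s > 0`) with `‖F z‖ ≤ M` there ⇒
`‖D²F(0)(Y, Y)‖ ≤ 16M∕s²·‖Y‖²` ([Chae1985] 13.6 on `closedBall 0 (s∕2)` with step `s∕4`: `‖D²F(0)‖ ≤ M∕(s∕4)²`).
[cite: Balaban1985Variational, (53)–(54) p.286; Chae1985, 13.6] -/
theorem norm_iteratedFDeriv_two_apply_le_of_ball_bound {G : E → F} {s M : ℝ} (hs : 0 < s) (hG : DifferentiableOn ℂ G {z : E | ‖z‖ < s})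
    (hM : ∀ z : E, ‖z‖ < s → ‖G z‖ ≤ M) (Y : E) :
    ‖iteratedFDeriv ℂ 2 G 0 (fun _ => Y)‖ ≤ 16 * M / s ^ 2 * ‖Y‖ ^ 2 := by
  have hρU : closedBall (0 : E) (s / 2) ⊆ {z : E | ‖z‖ < s} := fun z hz => by
    rw [mem_closedBall, dist_zero_right] at hz
    show ‖z‖ < s
    linarith
  have hM' : ∀ z ∈ closedBall (0 : E) (s / 2), ‖G z‖ ≤ M := fun z hz => by
    rw [mem_closedBall, dist_zero_right] at hz
    exact hM z (by linarith)
  have h := norm_iteratedFDeriv_le_of_closedBall hG (isOpen_normBall s) hρU hM' (by positivity : (0 : ℝ) < s / 4) 2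
    (by push_cast; linarith) (x' := 0) (by rw [mem_closedBall, dist_self]; push_cast; linarith)
  have hop : ‖iteratedFDeriv ℂ 2 G 0‖ ≤ 16 * M / s ^ 2 := by
    refine h.trans (le_of_eq ?_)
    field_simp
    ring
  calc ‖iteratedFDeriv ℂ 2 G 0 (fun _ => Y)‖ ≤ ‖iteratedFDeriv ℂ 2 G 0‖ * ∏ _i : Fin 2, ‖Y‖ :=
        (iteratedFDeriv ℂ 2 G 0).le_opNorm _
    _ = ‖iteratedFDeriv ℂ 2 G 0‖ * ‖Y‖ ^ 2 := by rw [Fin.prod_const]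
    _ ≤ 16 * M / s ^ 2 * ‖Y‖ ^ 2 := mul_le_mul_of_nonneg_right hop (sq_nonneg _)

/-- A map complex-differentiable on `‖z‖ < s` (`s > 0`) is `C²` at `0` (indeed analytic: [Chae1985] Thm 14.13). [cite: Chae1985, Thm 14.13] -/
theorem contDiffAt_two_of_differentiableOn {G : E → F} {s : ℝ} (hs : 0 < s) (hG : DifferentiableOn ℂ G {z : E | ‖z‖ < s}) :
    ContDiffAt ℂ 2 G 0 :=
  (analyticOnNhd_of_differentiableOn hG (isOpen_normBall s) 0 (show ‖(0 : E)‖ < s by rw [norm_zero]; exact hs)).contDiffAt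

/-- **ADDITIVITY OF `D²(·)(0)`** for maps holomorphic on a ball: `D²(F − G)(0) = D²F(0) − D²G(0)` (Mathlib's `iteratedFDeriv_sub_apply` at `C²` points).
[folklore] [cite: Balaban1985Variational, (56) p.286] -/
theorem iteratedFDeriv_two_sub_apply {G₁ G₂ : E → F} {s : ℝ} (hs : 0 < s) (h₁ : DifferentiableOn ℂ G₁ {z : E | ‖z‖ < s})
    (h₂ : DifferentiableOn ℂ G₂ {z : E | ‖z‖ < s}) (m : Fin 2 → E) :
    iteratedFDeriv ℂ 2 (fun z => G₁ z - G₂ z) 0 m = iteratedFDeriv ℂ 2 G₁ 0 m - iteratedFDeriv ℂ 2 G₂ 0 m := by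
  have h := iteratedFDeriv_sub_apply (contDiffAt_two_of_differentiableOn hs h₁) (contDiffAt_two_of_differentiableOn hs h₂)
  rw [show (fun z => G₁ z - G₂ z) = G₁ - G₂ from rfl, h]
  rfl

/-- **`D²(F ∘ ι)(0)(Y, Y) = D²F(0)(ιY, ιY)`** for a continuous linear `ι` and `F` holomorphic on `‖z‖ < s` (`s > 0`): Mathlib's
`ContinuousLinearMap.iteratedFDerivWithin_comp_right` on the open ball and its (open) preimage, read at `0`. [folklore]
[cite: Balaban1985Variational, (56) p.286, (117) p.295] -/
theorem iteratedFDeriv_two_comp_clm_apply {G : E' → F} {s : ℝ} (hs : 0 < s) (hG : DifferentiableOn ℂ G {z : E' | ‖z‖ < s})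
    (ι : E →L[ℂ] E') (Y : E) :
    iteratedFDeriv ℂ 2 (fun z => G (ι z)) 0 (fun _ => Y) = iteratedFDeriv ℂ 2 G 0 (fun _ => ι Y) := by
  have hU : IsOpen {z : E' | ‖z‖ < s} := isOpen_normBall s
  have hV : IsOpen (ι ⁻¹' {z : E' | ‖z‖ < s}) := hU.preimage ι.continuous
  have h0U : ι 0 ∈ {z : E' | ‖z‖ < s} := by show ‖ι 0‖ < s; rw [map_zero, norm_zero]; exact hs
  have h0V : (0 : E) ∈ ι ⁻¹' {z : E' | ‖z‖ < s} := h0U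
  have hcd : ContDiffOn ℂ 2 G {z : E' | ‖z‖ < s} := (analyticOnNhd_of_differentiableOn hG hU).contDiffOn hU.uniqueDiffOn
  have h := ι.iteratedFDerivWithin_comp_right hcd hU.uniqueDiffOn hV.uniqueDiffOn h0U (i := 2) le_rfl
  rw [show (fun z => G (ι z)) = G ∘ ι from rfl, ← iteratedFDerivWithin_of_isOpen 2 hV h0V, h,
    ContinuousMultilinearMap.compContinuousLinearMap_apply, iteratedFDerivWithin_of_isOpen 2 hU h0U, map_zero]

end Generic

/-! ## §2 On the carriers (115): the quadratic letter `F^{(2)}(Y) = ½·D²F(0)(Y, Y)` -/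

section Carriers

variable {𝔸 : Type*} [NormedRing 𝔸] [NormedAlgebra ℂ 𝔸]
variable {d : ℕ} {Pd : Fin d → ℕ} {L η : ℝ} [Fact (0 < L)] [Fact (0 < η)] {lev₀ : Bond d Pd → ℕ} {κ' : Type*} [Fintype κ']
  {lev₁ : κ' → ℕ} {Dc₁ Dc₂ : (Bond d Pd → 𝔸) →ₗ[ℂ] (κ' → 𝔸)}
variable {𝒳 : Type*} [NormedAddCommGroup 𝒳] [NormedSpace ℂ 𝒳] [CompleteSpace 𝒳]

/-- **`‖F^{(2)}(Y)‖ ≤ 8M∕s²·‖Y‖²`** for `F` holomorphic on `‖z‖ < s` with `‖F‖ ≤ M` there (§1 and `‖½‖ = ½`).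
[cite: Balaban1985Variational, (53)–(56) p.286] -/
theorem norm_quadPart_le_of_ball_bound {F : Space115 L η lev₀ lev₁ Dc₁ → 𝒳} {s M : ℝ} (hs : 0 < s)
    (hF : DifferentiableOn ℂ F {z : Space115 L η lev₀ lev₁ Dc₁ | ‖z‖ < s}) (hM : ∀ z : Space115 L η lev₀ lev₁ Dc₁, ‖z‖ < s → ‖F z‖ ≤ M)
    (Y : Space115 L η lev₀ lev₁ Dc₁) : ‖quadPart F Y‖ ≤ 8 * M / s ^ 2 * ‖Y‖ ^ 2 := by
  rw [quadPart, norm_smul, norm_inv, Complex.norm_ofNat]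
  have h := norm_iteratedFDeriv_two_apply_le_of_ball_bound hs hF hM Y
  calc 2⁻¹ * ‖iteratedFDeriv ℂ 2 F 0 fun _ => Y‖ ≤ 2⁻¹ * (16 * M / s ^ 2 * ‖Y‖ ^ 2) := mul_le_mul_of_nonneg_left h (by norm_num)
    _ = 8 * M / s ^ 2 * ‖Y‖ ^ 2 := by ring

/-- **`(F − G)^{(2)} = F^{(2)} − G^{(2)}`** for maps holomorphic on a ball. [folklore] [cite: Balaban1985Variational, (56) p.286] -/
theorem quadPart_sub {F G : Space115 L η lev₀ lev₁ Dc₁ → 𝒳} {s : ℝ} (hs : 0 < s) (hF : DifferentiableOn ℂ F {z : Space115 L η lev₀ lev₁ Dc₁ | ‖z‖ < s})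
    (hG : DifferentiableOn ℂ G {z : Space115 L η lev₀ lev₁ Dc₁ | ‖z‖ < s}) (Y : Space115 L η lev₀ lev₁ Dc₁) :
    quadPart (fun z => F z - G z) Y = quadPart F Y - quadPart G Y := by
  rw [quadPart, quadPart, quadPart, iteratedFDeriv_two_sub_apply hs hF hG, smul_sub]

/-- **`(G ∘ ι)^{(2)}(Y) = G^{(2)}(ιY)`** for a continuous linear `ι` between two carriers (115) and `G` holomorphic on a ball of the second.
[folklore] [cite: Balaban1985Variational, (56) p.286, (117) p.295] -/
theorem quadPart_comp_clm {G : Space115 L η lev₀ lev₁ Dc₂ → 𝒳} {s : ℝ} (hs : 0 < s) (hG : DifferentiableOn ℂ G {z : Space115 L η lev₀ lev₁ Dc₂ | ‖z‖ < s})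
    (ι : Space115 L η lev₀ lev₁ Dc₁ →L[ℂ] Space115 L η lev₀ lev₁ Dc₂) (Y : Space115 L η lev₀ lev₁ Dc₁) :
    quadPart (fun z => G (ι z)) Y = quadPart G (ι Y) := by
  rw [quadPart, quadPart, iteratedFDeriv_two_comp_clm_apply hs hG ι Y]

end Carriers

/-! ## §3 The quadratic letter `HC^{(2)}` across two carriers: δ_Q from δ_H and δ_C -/

section QuadLetter

variable {𝔸 : Type*} [NormedRing 𝔸] [NormedAlgebra ℂ 𝔸]
variable {d : ℕ} {Pd : Fin d → ℕ} {L η : ℝ} [Fact (0 < L)] [Fact (0 < η)] {lev₀ : Bond d Pd → ℕ} {κ' : Type*} [Fintype κ']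
  {lev₁ : κ' → ℕ} {Dc₁ Dc₂ : (Bond d Pd → 𝔸) →ₗ[ℂ] (κ' → 𝔸)}
variable {𝒳 : Type*} [NormedAddCommGroup 𝒳] [NormedSpace ℂ 𝒳] [CompleteSpace 𝒳]
  {C₁ : Space115 L η lev₀ lev₁ Dc₁ → 𝒳} {C₂ : Space115 L η lev₀ lev₁ Dc₂ → 𝒳} {H₁ : 𝒳 →L[ℂ] Space115 L η lev₀ lev₁ Dc₁}
  {H₂ : 𝒳 →L[ℂ] Space115 L η lev₀ lev₁ Dc₂} {ι : Space115 L η lev₀ lev₁ Dc₁ →L[ℂ] Space115 L η lev₀ lev₁ Dc₂} {c s Cq Kι b δH δC : ℝ}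

/-- **δ_Q FROM δ_H AND δ_C**: `‖ι(H₁C₁^{(2)}(x)) − H₂C₂^{(2)}(ιx)‖ ≤ (8C_qδ_H + 8bδ_C∕s²)·‖x‖²` for every `x` — `ι(H₁q₁) − H₂q₂ = (ιH₁ − H₂)q₁ + H₂(q₁ − q₂)`
with `q₁ = C₁^{(2)}(x)`, `q₂ = C₂^{(2)}(ιx) = (C₂ ∘ ι)^{(2)}(x)`, `q₁ − q₂ = (C₁ − C₂ ∘ ι)^{(2)}(x)` (§2), `‖q₁‖ ≤ 8C_q‖x‖²` and `‖q₁ − q₂‖ ≤ 8δ_C∕s²·‖x‖²` by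
Cauchy (§2) from `‖C₁Y‖ ≤ C_q‖Y‖²` on `‖Y‖ < c` and `‖C₁y − C₂(ιy)‖ ≤ δ_C` on `‖y‖ < s` (`0 < s ≤ c`, `K_ιs ≤ c`, `‖ιv‖ ≤ K_ι‖v‖`, `K_ι > 0`).
[cite: Balaban1985Variational, (56) p.286, (78) p.290, (53)–(54) p.286] -/
theorem norm_quadLetter_sub_le (hc : 0 < c) (hs : 0 < s) (hsc : s ≤ c) (hKι : 0 < Kι) (hKs : Kι * s ≤ c) (hCq : 0 ≤ Cq) (hδH : 0 ≤ δH)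
    (hC₁ : DifferentiableOn ℂ C₁ {z : Space115 L η lev₀ lev₁ Dc₁ | ‖z‖ < c}) (hC₂ : DifferentiableOn ℂ C₂ {z : Space115 L η lev₀ lev₁ Dc₂ | ‖z‖ < c})
    (hq : ∀ Y : Space115 L η lev₀ lev₁ Dc₁, ‖Y‖ < c → ‖C₁ Y‖ ≤ Cq * ‖Y‖ ^ 2) (hιn : ∀ v : Space115 L η lev₀ lev₁ Dc₁, ‖ι v‖ ≤ Kι * ‖v‖)
    (hH₂ : ‖H₂‖ ≤ b) (hdH : ∀ B : 𝒳, ‖ι (H₁ B) - H₂ B‖ ≤ δH * ‖B‖)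
    (hdC : ∀ y : Space115 L η lev₀ lev₁ Dc₁, ‖y‖ < s → ‖C₁ y - C₂ (ι y)‖ ≤ δC) (x : Space115 L η lev₀ lev₁ Dc₁) :
    ‖ι (H₁ (quadPart C₁ x)) - H₂ (quadPart C₂ (ι x))‖ ≤ (8 * Cq * δH + 8 * b * δC / s ^ 2) * ‖x‖ ^ 2 := by
  -- the restricted difference map on `‖y‖ < s`
  have hC₁s : DifferentiableOn ℂ C₁ {z : Space115 L η lev₀ lev₁ Dc₁ | ‖z‖ < s} := hC₁.mono fun z hz => lt_of_lt_of_le hz hsc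
  have hC₂ι : DifferentiableOn ℂ (fun z : Space115 L η lev₀ lev₁ Dc₁ => C₂ (ι z)) {z : Space115 L η lev₀ lev₁ Dc₁ | ‖z‖ < s} := by
    refine hC₂.comp ι.differentiableOn fun z hz => ?_
    show ‖ι z‖ < c
    have hz' : ‖z‖ < s := hz
    exact (hιn z).trans_lt ((mul_lt_mul_of_pos_left hz' hKι).trans_le hKs)
  -- the two quadratic pieces
  have hq₁ : ‖quadPart C₁ x‖ ≤ 8 * (Cq * c ^ 2) / c ^ 2 * ‖x‖ ^ 2 :=
    norm_quadPart_le_of_ball_bound hc hC₁ (fun z hz => (hq z hz).trans (by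
      exact mul_le_mul_of_nonneg_left (pow_le_pow_left₀ (norm_nonneg _) hz.le 2) hCq)) x
  have hq₁' : ‖quadPart C₁ x‖ ≤ 8 * Cq * ‖x‖ ^ 2 := by
    refine hq₁.trans (le_of_eq ?_)
    field_simp
  have hdiff : quadPart C₁ x - quadPart C₂ (ι x) = quadPart (fun z => C₁ z - C₂ (ι z)) x := by
    rw [quadPart_sub hs hC₁s hC₂ι, quadPart_comp_clm hc hC₂ ι x]
  have hq₂ : ‖quadPart C₁ x - quadPart C₂ (ι x)‖ ≤ 8 * δC / s ^ 2 * ‖x‖ ^ 2 := by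
    rw [hdiff]
    exact norm_quadPart_le_of_ball_bound hs (hC₁s.sub hC₂ι) hdC x
  -- assemble
  have e : ι (H₁ (quadPart C₁ x)) - H₂ (quadPart C₂ (ι x)) =
      (ι (H₁ (quadPart C₁ x)) - H₂ (quadPart C₁ x)) + H₂ (quadPart C₁ x - quadPart C₂ (ι x)) := by
    rw [map_sub]; abel
  rw [e]
  refine (norm_add_le _ _).trans ?_
  have h1 : ‖ι (H₁ (quadPart C₁ x)) - H₂ (quadPart C₁ x)‖ ≤ δH * (8 * Cq * ‖x‖ ^ 2) :=
    (hdH _).trans (mul_le_mul_of_nonneg_left hq₁' hδH)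
  have h2 : ‖H₂ (quadPart C₁ x - quadPart C₂ (ι x))‖ ≤ b * (8 * δC / s ^ 2 * ‖x‖ ^ 2) :=
    (H₂.le_opNorm _).trans (mul_le_mul hH₂ hq₂ (norm_nonneg _) ((norm_nonneg _).trans hH₂))
  refine (add_le_add h1 h2).trans (le_of_eq ?_)
  ring

/-- **THE (δ_Q) DISPLAY OF `exists_W80_background_modulus` DISCHARGED FROM δ_H, δ_C**: on `‖x‖ < a_C`,
`‖ι(H₁C₁^{(2)}(x)) − H₂C₂^{(2)}(ιx)‖ ≤ δ_Q` with `δ_Q := (8C_qδ_H + 8bδ_C∕s²)·a_C²`. [cite: Balaban1985Variational, (78) p.290, (56) p.286] -/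
theorem quadLetter_modulus_on_ball (hc : 0 < c) (hs : 0 < s) (hsc : s ≤ c) (hKι : 0 < Kι) (hKs : Kι * s ≤ c) (hCq : 0 ≤ Cq) (hδC : 0 ≤ δC)
    (hC₁ : DifferentiableOn ℂ C₁ {z : Space115 L η lev₀ lev₁ Dc₁ | ‖z‖ < c}) (hC₂ : DifferentiableOn ℂ C₂ {z : Space115 L η lev₀ lev₁ Dc₂ | ‖z‖ < c})
    (hq : ∀ Y : Space115 L η lev₀ lev₁ Dc₁, ‖Y‖ < c → ‖C₁ Y‖ ≤ Cq * ‖Y‖ ^ 2) (hιn : ∀ v : Space115 L η lev₀ lev₁ Dc₁, ‖ι v‖ ≤ Kι * ‖v‖)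
    (hH₂ : ‖H₂‖ ≤ b) (hδH : 0 ≤ δH) (hdH : ∀ B : 𝒳, ‖ι (H₁ B) - H₂ B‖ ≤ δH * ‖B‖)
    (hdC : ∀ y : Space115 L η lev₀ lev₁ Dc₁, ‖y‖ < s → ‖C₁ y - C₂ (ι y)‖ ≤ δC) {aC : ℝ} (x : Space115 L η lev₀ lev₁ Dc₁) (hx : ‖x‖ < aC) :
    ‖ι (H₁ (quadPart C₁ x)) - H₂ (quadPart C₂ (ι x))‖ ≤ (8 * Cq * δH + 8 * b * δC / s ^ 2) * aC ^ 2 := by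
  have hb : 0 ≤ b := (norm_nonneg _).trans hH₂
  have hK : 0 ≤ 8 * Cq * δH + 8 * b * δC / s ^ 2 := by positivity
  exact (norm_quadLetter_sub_le hc hs hsc hKι hKs hCq hδH hC₁ hC₂ hq hιn hH₂ hdH hdC x).trans
    (mul_le_mul_of_nonneg_left (pow_le_pow_left₀ (norm_nonneg _) hx.le 2) hK)

end QuadLetter

end Literature.MathematicalPhysics.QuantumFieldTheory.Balaban1983to89.B11Eq78QuadLetterModulus

end
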